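import Literature.Analysis.SpecialFunctions.GaussGammaRatioAsymptotics
import Mathlib.Analysis.Polynomial.Basic
import Mathlib.Analysis.Calculus.Deriv.Polynomial
import Mathlib.Algebra.Polynomial.Div
import Mathlib.Analysis.SpecialFunctions.Trigonometric.Deriv
import HarnessLib

/-!
# Booker 2003 — proved pieces of the printed proof, II: Lemma 3 ((12)–(14)) and (21)–(22)

Sibling of `Automorphic/BookerStrongArtin.lean` (the named fact
`booker_strongArtin_of_artinConjecture`, Booker's Corollary, Ann. of Math. 158 (2003), p. 1090) and
of `BookerStrongArtinProofs.lean` (equation (23), the odd case). Everything here is PROVED; there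
are no named facts.

**Lemma 3** (p. 1094, even case, `γ(s) = π^{−s} Γ((s+a)/2)²`, `a ∈ {0,1}`): "Let `m` be given.
Then there are numbers `b_k`, with `b_m > 0`, such that for any `n`

  `π^{−s} Γ((s+a)/2)² (s − 1/2)^{m−a} = Σ_{k=n}^{m} b_k (2π)^{−s} Γ(s+k−1/2) + (2π)^{−s} Γ(s+n−1/2) E_n(s)`, (12)

where `E_n(s)` is holomorphic and `O(1/s)` in `Re s > 1`." — `Literature.NumberTheory.Automorphic.Booker2003.exists_evenGammaFactor_mul_sub_half_pow_eq_sum`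
(for every `a ≤ m` in `ℕ` and every integer `n ≤ m`, with `b_m = 2^{−a}√(8π)` as in (14)). This is
the form in which the `Γ`-factor of (3) is fed to the Conrey–Ghosh transform (Lemma 2,
`Literature/NumberTheory/LFunctions/ConreyGhoshTransform.lean`) in (17)–(19), with `n = −1`, `m = 2`.

## Proof (as printed, (13)–(14), with (13) obtained WITHOUT Stirling's series)

Booker: "Stirling's formula gives, for `Re s ≥ 1`,
`Γ(s/2)²/(2^{−s}Γ(s−1/2)) = √(8π)(1 + c₁/s + ⋯ + c_n/s^n + O(s^{−n−1}))` (13)". By the duplication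
formula `Γ(s/2)²/(2^{−s}Γ(s−1/2)) = √(8π) G(s/2)` with `G(v) = Γ(v)²/(Γ(v−¼)Γ(v+¼))`, and `G` is
the value `₂F₁(¼, −¼; v; 1)` of Gauss's summation theorem; its inverse-factorial expansion to
every order, uniformly on `Re v > 0`, is
`Literature.Analysis.SpecialFunctions.GaussRatio.norm_gaussRatio_sub_partialSum_le`
(`GaussGammaRatioAsymptotics.lean`). This gives (13) in the basis `1/((s/2)(s/2+1)⋯)`
(`gammaFactor_ratio_expansion`), equivalent to Booker's to every order. Then, as in (14): put
`F_n(s) = c_a G((s+a)/2)(s−1/2)^{m−a} Γ(s+a−1/2)/Γ(s+n−1/2)` (`c_a = 2^{−a}√(8π)`), so that (12) reads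
`F_n = P_n + E_n` with `P_n(s) = Σ_k b_k Γ(s+k−1/2)/Γ(s+n−1/2)` a polynomial; the polynomial part
`P_n` is produced by Euclidean division of `2^k (s−1/2)^{m−a}∏(s+i−1/2)` by
`∏(s+a+j−1/2)·∏_{i<k}(s+a+2i)` (`stepA_large`: `‖F_n − P_n‖ ≤ K/‖s‖` for `‖s‖` large; `stepA`:
plus continuity on the compact part of `Re s ≥ 1`), and the independence of the `b_k` from `n` is
the remark that `P_n − (s+n−1/2)P_{n+1} = −E_n + (s+n−1/2)E_{n+1}` is a bounded, hence constant,
polynomial (`polyP_sub_eq_C`, `polyP_newton`).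

## Main results

* `Literature.NumberTheory.Automorphic.Booker2003.gammaFactor_ratio_expansion` — Booker's (13) (inverse-factorial form).
* `Literature.NumberTheory.Automorphic.Booker2003.bCoeff_two_one`, `Literature.NumberTheory.Automorphic.Booker2003.phi_one_eq` — the case `m = 2` of
  p. 1097: `b₁/b₂ = −9/8`, hence (22) equals `−(b₂/2)(2π)^{−s}Γ(s+1/2)(s−1)²` ("the above
  polynomial must be `(s−1)²`"), by direct computation instead of the `L(s,χ)²` comparison.
* `Literature.NumberTheory.Automorphic.Booker2003.deltaKernel_zero_of_even`, `Literature.NumberTheory.Automorphic.Booker2003.hasDerivAt_deltaKernel_two` —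
  (21)–(22): for the kernel `Σ_k b_k(2π)^{−s}Γ(s+k−1/2)(2 sin(δ/2))^{m−k} sin((δ/2)(s−k−1/2)+πk/2)`,
  `φ₀ ≡ 0` for even `m`, and for `m = 2` the `δ`-derivative at `0` is Booker's `φ₁(s)`.
* `Literature.NumberTheory.Automorphic.Booker2003.exists_evenGammaFactor_mul_sub_half_pow_eq_sum` — Booker's
  Lemma 3, i.e. (12), for all `a ≤ m`, `n ≤ m` (companion of the odd case
  `Booker2003.exists_oddGammaFactor_mul_sub_half_pow_eq_sum` in `BookerStrongArtinProofs.lean`).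

## References

* A. R. Booker, *Poles of Artin L-functions and the strong Artin conjecture*, Ann. of Math. (2)
  158 (2003), 1089–1098: Lemma 3, (12)–(14), p. 1094. [Booker2003]
* lemma3E. T. Whittaker, G. N. Watson, *A Course of Modern Analysis*, 4th ed. (1927), §14·11 (Gauss's
  theorem), §12·15 (duplication formula). [WhittakerWatson1927]
-/

noncomputable section

open Complex Filter Topology Finset Polynomial

open Literature.Analysis.SpecialFunctions Literature.Analysis.SpecialFunctions.GaussRatio

namespace Literature.NumberTheory.Automorphic

namespace Booker2003

/-! ### Polynomial bookkeeping: products of real monic linear factors -/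

/-- `∏_{j<N} (X + c_j)` over `ℝ`. [folklore] -/
def linProd (c : ℕ → ℝ) (N : ℕ) : ℝ[X] := ∏ j ∈ Finset.range N, (X + C (c j))

/-- `linProd` is monic. [folklore] -/
lemma monic_linProd (c : ℕ → ℝ) (N : ℕ) : (linProd c N).Monic :=
  monic_prod_of_monic _ _ fun j _ => monic_X_add_C (c j)

/-- `linProd c N` has degree `N`. [folklore] -/
lemma natDegree_linProd (c : ℕ → ℝ) (N : ℕ) : (linProd c N).natDegree = N := by
  rw [linProd, natDegree_prod_of_monic _ _ (fun j _ => monic_X_add_C (c j))]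
  simp

/-- Evaluation of `linProd` at a complex point. [folklore] -/
lemma aeval_linProd (c : ℕ → ℝ) (N : ℕ) (s : ℂ) :
    aeval s (linProd c N) = ∏ j ∈ Finset.range N, (s + (c j : ℂ)) := by
  simp [linProd, map_prod]

/-- `linProd c (N+1) = linProd c N · (X + c_N)`. [folklore] -/
lemma linProd_succ (c : ℕ → ℝ) (N : ℕ) : linProd c (N + 1) = linProd c N * (X + C (c N)) := by
  simp [linProd, Finset.prod_range_succ]

/-- `linProd c (N+1) = (X + c_0) · ∏_{j<N} (X + c_{j+1})`. [folklore] -/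
lemma linProd_succ' (c : ℕ → ℝ) (N : ℕ) :
    linProd c (N + 1) = (X + C (c 0)) * linProd (fun j => c (j + 1)) N := by
  simp [linProd, Finset.prod_range_succ', mul_comm]

/-- `linProd c 0 = 1`. [folklore] -/
@[simp] lemma linProd_zero (c : ℕ → ℝ) : linProd c 0 = 1 := by simp [linProd]

/-- For `Re s > 1` and real `c ≥ −1/2`: `‖s + c‖ ≥ ‖s‖/2`. [folklore] -/
lemma half_norm_le_norm_add {s : ℂ} (hs : 1 < s.re) {c : ℝ} (hc : -1 / 2 ≤ c) :
    ‖s‖ / 2 ≤ ‖s + c‖ := by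
  have h1 : (‖s‖ / 2) ^ 2 ≤ ‖s + (c : ℂ)‖ ^ 2 := by
    rw [div_pow, Complex.sq_norm, Complex.sq_norm, Complex.normSq_apply, Complex.normSq_apply]
    simp only [add_re, ofReal_re, add_im, ofReal_im, add_zero]
    nlinarith [sq_nonneg (s.re + c), sq_nonneg s.im]
  exact le_of_pow_le_pow_left₀ two_ne_zero (norm_nonneg _) h1

/-- Lower bound `‖linProd(s)‖ ≥ (‖s‖/2)^N` when all `c_j ≥ −1/2` and `Re s > 1`. [folklore] -/
lemma pow_le_norm_aeval_linProd {c : ℕ → ℝ} (hc : ∀ j, -1 / 2 ≤ c j) (N : ℕ) {s : ℂ}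
    (hs : 1 < s.re) : (‖s‖ / 2) ^ N ≤ ‖aeval s (linProd c N)‖ := by
  rw [aeval_linProd, norm_prod]
  calc (‖s‖ / 2) ^ N = ∏ _j ∈ Finset.range N, ‖s‖ / 2 := by
        rw [Finset.prod_const, Finset.card_range]
    _ ≤ ∏ j ∈ Finset.range N, ‖s + (c j : ℂ)‖ :=
        Finset.prod_le_prod (fun _ _ => by positivity) fun j _ => half_norm_le_norm_add hs (hc j)

/-- `linProd(s) ≠ 0` when all `c_j ≥ −1/2` and `Re s > 1/2` (every factor has positive real part).
[folklore] -/
lemma aeval_linProd_ne_zero {c : ℕ → ℝ} (hc : ∀ j, -1 / 2 ≤ c j) (N : ℕ) {s : ℂ}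
    (hs : 1 / 2 < s.re) : aeval s (linProd c N) ≠ 0 := by
  rw [aeval_linProd, Finset.prod_ne_zero_iff]
  intro j _ h
  have := congrArg Complex.re h
  simp at this
  linarith [hc j]

/-- `ℓ¹`-norm of the coefficients. [folklore] -/
def l1norm (p : ℝ[X]) : ℝ := ∑ i ∈ Finset.range (p.natDegree + 1), |p.coeff i|

/-- `ℓ¹`-norm is nonnegative. [folklore] -/
lemma l1norm_nonneg (p : ℝ[X]) : 0 ≤ l1norm p := Finset.sum_nonneg fun _ _ => abs_nonneg _

/-- `‖p(s)‖ ≤ ‖p‖₁ ‖s‖^{deg p}` for `‖s‖ ≥ 1`. [folklore] -/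
lemma norm_aeval_le (p : ℝ[X]) {s : ℂ} (hs : 1 ≤ ‖s‖) :
    ‖aeval s p‖ ≤ l1norm p * ‖s‖ ^ p.natDegree := by
  rw [aeval_eq_sum_range, l1norm, Finset.sum_mul]
  refine (norm_sum_le _ _).trans (Finset.sum_le_sum fun i hi => ?_)
  rw [Algebra.smul_def, norm_mul, norm_pow]
  have h1 : ‖algebraMap ℝ ℂ (p.coeff i)‖ = |p.coeff i| := by simp
  rw [h1]
  refine mul_le_mul_of_nonneg_left ?_ (abs_nonneg _)
  exact pow_le_pow_right₀ hs (by have := Finset.mem_range.mp hi; omega)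

/-! ### Booker's objects -/

/-- Booker's (real) Gauss coefficients for `a = 1/4, b = −1/4`: `q_k = (1/4)_k (−1/4)_k / k!`.
[folklore] -/
def q4 : ℕ → ℝ
  | 0 => 1
  | k + 1 => q4 k * ((k + 1 / 4) * (k - 1 / 4) / (k + 1))

/-- `GaussRatio.coeff (1/4) (−1/4) k = q4 k`. [folklore] -/
lemma coeff_quarter (k : ℕ) : GaussRatio.coeff (1 / 4) (-1 / 4) k = (q4 k : ℂ) := by
  induction k with
  | zero => simp [q4]
  | succ k ih =>
    rw [GaussRatio.coeff_succ, ih, q4]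
    push_cast
    ring

/-- Booker's leading coefficient `b_m = 2^{−a} √(8π)`. [cite: Booker2003, (14) p. 1094] -/
def bTop (a : ℕ) : ℝ := Real.sqrt (8 * Real.pi) / 2 ^ a

/-- `bTop a > 0`. [folklore] -/
lemma bTop_pos (a : ℕ) : 0 < bTop a := by
  unfold bTop
  have : 0 < Real.sqrt (8 * Real.pi) := Real.sqrt_pos.mpr (by positivity)
  positivity

/-- Numerator polynomial `A_n = (X − 1/2)^{m−a} ∏_{j < a−n} (X + n + j − 1/2)`. [folklore] -/
def polyA (a m : ℕ) (n : ℤ) : ℝ[X] :=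
  linProd (fun _ => -1 / 2) (m - a) * linProd (fun j => (n : ℝ) + j - 1 / 2) (a - n).toNat

/-- Denominator polynomial `B_n = ∏_{j < n−a} (X + a + j − 1/2)`. [folklore] -/
def polyB (a : ℕ) (n : ℤ) : ℝ[X] := linProd (fun j => (a : ℝ) + j - 1 / 2) (n - a).toNat

/-- `Π_k = ∏_{i<k} (X + a + 2i)` (so that `φ_k((s+a)/2) = 2^k/Π_k(s)`). [folklore] -/
def polyPi (a k : ℕ) : ℝ[X] := linProd (fun i => (a : ℝ) + 2 * i) k

/-- Booker's polynomial part `P_n = c_a Σ_{k ≤ m−n} q_k 2^k · (A_n div (B_n Π_k))`. [folklore] -/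
def polyP (a m : ℕ) (n : ℤ) : ℝ[X] :=
  C (bTop a) * ∑ k ∈ Finset.range ((m - n).toNat + 1),
    C (q4 k * 2 ^ k) * (polyA a m n /ₘ (polyB a n * polyPi a k))

/-- The function expanded in Lemma 3, divided by `(2π)^{-s} Γ(s + n − 1/2)`:
`F_n(s) = c_a G((s+a)/2) (s − 1/2)^{m−a} Γ(s + a − 1/2)/Γ(s + n − 1/2)`, `G = gaussRatio ¼ (−¼)`.
[folklore] -/
def lemma3F (a m : ℕ) (n : ℤ) (s : ℂ) : ℂ :=
  (bTop a : ℂ) * gaussRatio (1 / 4) (-1 / 4) ((s + a) / 2) * (s - 1 / 2) ^ (m - a) *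
    (Gamma (s + a - 1 / 2) * (Gamma (s + n - 1 / 2))⁻¹)

/-- Booker's error term `E_n = F_n − P_n`. [cite: Booker2003, Lemma 3 p. 1094] -/
def lemma3E (a m : ℕ) (n : ℤ) (s : ℂ) : ℂ := lemma3F a m n s - aeval s (polyP a m n)

/-! ### Exact identities -/

/-- `1/Γ(z) = (∏_{j<N} (z+j)) / Γ(z+N)` for ALL `z` (Mathlib's `1/Γ` is entire and vanishes at the
poles). [folklore] -/
lemma inv_Gamma_eq_prod_mul (z : ℂ) (N : ℕ) :
    (Gamma z)⁻¹ = (∏ j ∈ Finset.range N, (z + j)) * (Gamma (z + N))⁻¹ := by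
  induction N with
  | zero => simp
  | succ N ih =>
    rw [Finset.prod_range_succ, ih, one_div_Gamma_eq_self_mul_one_div_Gamma_add_one (z + N)]
    push_cast
    ring_nf

/-- The exact recursion `F_n(s) = (s + n − 1/2) F_{n+1}(s)` (all `s`). [folklore] -/
lemma lemma3F_eq_mul_succ (a m : ℕ) (n : ℤ) (s : ℂ) :
    lemma3F a m n s = (s + n - 1 / 2) * lemma3F a m (n + 1) s := by
  unfold lemma3F
  rw [one_div_Gamma_eq_self_mul_one_div_Gamma_add_one (s + n - 1 / 2)]
  push_cast
  ring_nf

/-- `φ_k((s+a)/2) = 2^k / Π_k(s)`. [folklore] -/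
lemma invRising_half (a k : ℕ) (s : ℂ) :
    invRising ((s + a) / 2) k = 2 ^ k / aeval s (polyPi a k) := by
  unfold invRising polyPi
  rw [aeval_linProd]
  have : ∏ i ∈ Finset.range k, ((s + a) / 2 + (i : ℂ)) =
      (∏ i ∈ Finset.range k, (s + (((a : ℝ) + 2 * i : ℝ) : ℂ))) / 2 ^ k := by
    rw [eq_div_iff (pow_ne_zero k two_ne_zero),
      show (2 : ℂ) ^ k = ∏ _i ∈ Finset.range k, (2 : ℂ) by
        rw [Finset.prod_const, Finset.card_range],
      ← Finset.prod_mul_distrib]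
    refine Finset.prod_congr rfl fun i _ => ?_
    push_cast
    ring
  rw [this, inv_div]

/-- The bridge between the `Γ`-ratio and the rational function `A'_n/B_n` on `Re s ≥ 1`:
`Γ(s + a − 1/2)/Γ(s + n − 1/2) = ∏_{j<a−n}(s + n + j − 1/2) / ∏_{j<n−a}(s + a + j − 1/2)`.
[folklore] -/
lemma Gamma_ratio_eq (a : ℕ) (n : ℤ) {s : ℂ} (hs : 1 ≤ s.re) :
    Gamma (s + a - 1 / 2) * (Gamma (s + n - 1 / 2))⁻¹ =
      aeval s (linProd (fun j => (n : ℝ) + j - 1 / 2) (a - n).toNat) / aeval s (polyB a n) := by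
  have hΓ : Gamma (s + a - 1 / 2) ≠ 0 := Gamma_ne_zero_of_re_pos (by simp; linarith)
  rcases le_or_gt n (a : ℤ) with hna | han
  · -- `n ≤ a`: the ratio is the polynomial `∏_{j < a-n} (s + n - 1/2 + j)`
    have hB : polyB a n = 1 := by
      rw [polyB, show (n - (a : ℤ)).toNat = 0 by omega, linProd_zero]
    have hN : (((a - n).toNat : ℕ) : ℂ) = (a : ℂ) - n := by
      have h := Int.toNat_of_nonneg (sub_nonneg.mpr hna)
      exact_mod_cast h
    rw [hB, map_one, div_one, inv_Gamma_eq_prod_mul (s + n - 1 / 2) (a - n).toNat, hN,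
      show s + (n : ℂ) - 1 / 2 + ((a : ℂ) - n) = s + a - 1 / 2 by ring, ← mul_assoc,
      mul_comm (Gamma _), mul_assoc, mul_inv_cancel₀ hΓ, mul_one, aeval_linProd]
    refine Finset.prod_congr rfl fun j _ => ?_
    push_cast
    ring
  · -- `a < n`: the ratio is `1/∏_{j < n-a} (s + a - 1/2 + j)`
    have hA : (a - n).toNat = 0 := by omega
    have hN : (((n - a).toNat : ℕ) : ℂ) = (n : ℂ) - a := by
      have h := Int.toNat_of_nonneg (sub_nonneg.mpr han.le)
      exact_mod_cast h
    have hc : ∀ j : ℕ, -1 / 2 ≤ (a : ℝ) + j - 1 / 2 := fun j => by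
      have := (a.cast_nonneg : (0 : ℝ) ≤ a); have := (j.cast_nonneg : (0 : ℝ) ≤ j); linarith
    have hB0 : aeval s (polyB a n) ≠ 0 := aeval_linProd_ne_zero hc _ (by linarith)
    have key := inv_Gamma_eq_prod_mul (s + a - 1 / 2) (n - a).toNat
    rw [hN, show s + (a : ℂ) - 1 / 2 + ((n : ℂ) - a) = s + n - 1 / 2 by ring] at key
    have hBv : aeval s (polyB a n) = ∏ j ∈ Finset.range (n - a).toNat, (s + a - 1 / 2 + j) := by
      rw [polyB, aeval_linProd]
      refine Finset.prod_congr rfl fun j _ => ?_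
      push_cast
      ring
    rw [hA, linProd_zero, map_one, eq_div_iff hB0, hBv]
    calc Gamma (s + a - 1 / 2) * (Gamma (s + n - 1 / 2))⁻¹ *
          ∏ j ∈ Finset.range (n - a).toNat, (s + a - 1 / 2 + j)
        = Gamma (s + a - 1 / 2) *
          ((∏ j ∈ Finset.range (n - a).toNat, (s + a - 1 / 2 + j)) * (Gamma (s + n - 1 / 2))⁻¹) := by
          ring
      _ = Gamma (s + a - 1 / 2) * (Gamma (s + a - 1 / 2))⁻¹ := by rw [← key]
      _ = 1 := mul_inv_cancel₀ hΓ

/-! ### Degrees and evaluations -/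

/-- `deg A_n = (m − a) + (a − n)⁺`. [folklore] -/
lemma natDegree_polyA (a m : ℕ) (n : ℤ) : (polyA a m n).natDegree = (m - a) + (a - n).toNat := by
  rw [polyA, (monic_linProd _ _).natDegree_mul (monic_linProd _ _), natDegree_linProd,
    natDegree_linProd]

/-- `A_n` is monic. [folklore] -/
lemma monic_polyA (a m : ℕ) (n : ℤ) : (polyA a m n).Monic :=
  (monic_linProd _ _).mul (monic_linProd _ _)

/-- `deg B_n = (n − a)⁺`. [folklore] -/
lemma natDegree_polyB (a : ℕ) (n : ℤ) : (polyB a n).natDegree = (n - a).toNat :=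
  natDegree_linProd _ _

/-- `B_n Π_k` is monic of degree `(n − a)⁺ + k`. [folklore] -/
lemma monic_polyD (a : ℕ) (n : ℤ) (k : ℕ) : (polyB a n * polyPi a k).Monic :=
  (monic_linProd _ _).mul (monic_linProd _ _)

/-- `deg (B_n Π_k) = (n − a)⁺ + k`. [folklore] -/
lemma natDegree_polyD (a : ℕ) (n : ℤ) (k : ℕ) :
    (polyB a n * polyPi a k).natDegree = (n - a).toNat + k := by
  rw [polyB, polyPi, (monic_linProd _ _).natDegree_mul (monic_linProd _ _), natDegree_linProd,
    natDegree_linProd]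

/-- The shifts in `B_n` are `≥ −1/2`. [folklore] -/
lemma polyB_shift_ge (a j : ℕ) : -1 / 2 ≤ (a : ℝ) + j - 1 / 2 := by
  have := (a.cast_nonneg : (0 : ℝ) ≤ a); have := (j.cast_nonneg : (0 : ℝ) ≤ j); linarith

/-- The shifts in `Π_k` are `≥ −1/2`. [folklore] -/
lemma polyPi_shift_ge (a i : ℕ) : -1 / 2 ≤ (a : ℝ) + 2 * i := by
  have := (a.cast_nonneg : (0 : ℝ) ≤ a); have := (i.cast_nonneg : (0 : ℝ) ≤ i); linarith

/-- `F_n = c_a G((s+a)/2) A_n(s)/B_n(s)` on `Re s ≥ 1`. [folklore] -/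
lemma lemma3F_eq (a m : ℕ) (n : ℤ) {s : ℂ} (hs : 1 ≤ s.re) :
    lemma3F a m n s = (bTop a : ℂ) * gaussRatio (1 / 4) (-1 / 4) ((s + a) / 2) *
      (aeval s (polyA a m n) / aeval s (polyB a n)) := by
  have h : ∏ _j ∈ Finset.range (m - a), (s + ((-1 / 2 : ℝ) : ℂ)) = (s - 1 / 2) ^ (m - a) := by
    rw [Finset.prod_const, Finset.card_range]
    congr 1
    push_cast
    ring
  unfold lemma3F
  rw [Gamma_ratio_eq a n hs]
  simp only [polyA, map_mul, aeval_linProd, h]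
  ring

/-- Evaluation of `P_n`. [folklore] -/
lemma aeval_polyP (a m : ℕ) (n : ℤ) (s : ℂ) :
    aeval s (polyP a m n) = (bTop a : ℂ) * ∑ k ∈ Finset.range ((m - n).toNat + 1),
      ((q4 k : ℂ) * 2 ^ k) * aeval s (polyA a m n /ₘ (polyB a n * polyPi a k)) := by
  simp only [polyP, map_mul, map_sum, aeval_C, Complex.coe_algebraMap]
  push_cast
  rfl

/-! ### Regularity of `F_n`, `E_n` on `Re s ≥ 1` -/

/-- `F_n` is complex differentiable at every `s` with `Re s ≥ 1`. [folklore] -/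
lemma differentiableAt_lemma3F (a m : ℕ) (n : ℤ) {s : ℂ} (hs : 1 ≤ s.re) :
    DifferentiableAt ℂ (lemma3F a m n) s := by
  have hv : 0 < ((s + a) / 2).re := by
    simp
    have := (a.cast_nonneg : (0 : ℝ) ≤ a)
    linarith
  have hG : DifferentiableAt ℂ (fun s : ℂ => gaussRatio (1 / 4) (-1 / 4) ((s + a) / 2)) s := by
    refine (differentiableAt_gaussRatio (1 / 4) (-1 / 4) (v := (s + a) / 2) ?_ ?_).comp
      (f := fun s : ℂ => (s + a) / 2) s ?_
    · intro k; simpa using add_nat_ne_neg_nat hv 0 k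
    · intro k
      have : (s + a) / 2 - 1 / 4 - -1 / 4 = (s + a) / 2 := by ring
      rw [this]
      simpa using add_nat_ne_neg_nat hv 0 k
    · exact (differentiableAt_id.add_const _).div_const _
  have hΓ1 : DifferentiableAt ℂ (fun s : ℂ => Gamma (s + a - 1 / 2)) s := by
    refine (differentiableAt_Gamma _ ?_).comp (f := fun s : ℂ => s + a - 1 / 2) s
      ((differentiableAt_id.add_const _).sub_const _)
    intro k
    have h1 : 0 < (s + a - 1 / 2).re := by
      simp
      have := (a.cast_nonneg : (0 : ℝ) ≤ a)
      linarith
    simpa using add_nat_ne_neg_nat h1 0 k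
  have hΓ2 : DifferentiableAt ℂ (fun s : ℂ => (Gamma (s + n - 1 / 2))⁻¹) s :=
    differentiable_one_div_Gamma.differentiableAt.comp (f := fun s : ℂ => s + n - 1 / 2) s
      ((differentiableAt_id.add_const _).sub_const _)
  unfold lemma3F
  exact (((differentiableAt_const _).mul hG).mul ((differentiableAt_id.sub_const _).pow _)).mul
    (hΓ1.mul hΓ2)

/-- `E_n` is complex differentiable at every `s` with `Re s ≥ 1`. [folklore] -/
lemma differentiableAt_lemma3E (a m : ℕ) (n : ℤ) {s : ℂ} (hs : 1 ≤ s.re) :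
    DifferentiableAt ℂ (lemma3E a m n) s :=
  (differentiableAt_lemma3F a m n hs).sub (Polynomial.differentiable_aeval _ _)

/-! ### Step A: `E_n = O(1/s)` for `|s|` large -/

/-- Elementary: from `0 ≤ X ≤ L t^{dA}`, `(t/2)^{dB} ≤ Y`, `0 ≤ G ≤ C/(t/2)^{d+1}` and
`dA = dB + d`: `G X / Y ≤ C L 2^{dA+1}/t` (`t ≥ 1`). [folklore] -/
lemma main_term_bound {t Gn Xn Yn Cg L : ℝ} {dA dB d : ℕ} (ht : 1 ≤ t)
    (hCg : 0 ≤ Cg) (hL : 0 ≤ L) (hXn : 0 ≤ Xn)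
    (hG : Gn ≤ Cg / (t / 2) ^ (d + 1)) (hX : Xn ≤ L * t ^ dA) (hYb : (t / 2) ^ dB ≤ Yn)
    (hdeg : dA = dB + d) :
    Gn * Xn / Yn ≤ Cg * L * 2 ^ (dA + 1) / t := by
  have ht0 : 0 < t := by linarith
  rw [div_pow] at hG hYb
  rw [div_div_eq_mul_div] at hG
  have num : Gn * Xn ≤ (Cg * 2 ^ (d + 1) / t ^ (d + 1)) * (L * t ^ dA) :=
    mul_le_mul hG hX hXn (by positivity)
  have h := div_le_div₀ (by positivity) num (by positivity) hYb
  refine h.trans (le_of_eq ?_)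
  rw [hdeg]
  field_simp
  ring

/-- Elementary: from `0 ≤ X ≤ L t^{N-1}`, `(t/2)^N ≤ Y`, `N ≥ 1`: `X/Y ≤ L 2^N / t`. [folklore] -/
lemma rem_term_bound {t Xn Yn L : ℝ} {N : ℕ} (ht : 1 ≤ t) (hXn : 0 ≤ Xn)
    (hX : Xn ≤ L * t ^ (N - 1)) (hYb : (t / 2) ^ N ≤ Yn) (hN : 1 ≤ N) :
    Xn / Yn ≤ L * 2 ^ N / t := by
  have ht0 : 0 < t := by linarith
  obtain ⟨M, rfl⟩ : ∃ M, N = M + 1 := ⟨N - 1, by omega⟩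
  simp only [Nat.add_sub_cancel] at hX
  rw [div_pow] at hYb
  have hL : 0 ≤ L * t ^ M := hXn.trans hX
  have h := div_le_div₀ hL hX (by positivity) hYb
  refine h.trans (le_of_eq ?_)
  field_simp
  ring

/-- **Step A (large `|s|`).** There are `R₀, K` with `‖E_n(s)‖ ≤ K/‖s‖` for `Re s > 1`,
`‖s‖ ≥ R₀`: the Gauss-ratio expansion to order `m − n`, Euclidean division of `2^k A_n` by
`B_n Π_k`, and the bounds `‖A_n(s)‖ ≪ ‖s‖^{deg A_n}`, `‖B_n(s)Π_k(s)‖ ≫ ‖s‖^{deg}`.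
[cite: Booker2003, (14) p. 1094] -/
lemma stepA_large (a m : ℕ) (ham : a ≤ m) (n : ℤ) (hn : n ≤ m) :
    ∃ R₀ K : ℝ, 0 < R₀ ∧ 0 ≤ K ∧ ∀ s : ℂ, 1 < s.re → R₀ ≤ ‖s‖ → ‖lemma3E a m n s‖ ≤ K / ‖s‖ := by
  set d := (m - n).toNat with hd
  obtain ⟨R, CG, hR, hCG, hG⟩ := norm_gaussRatio_sub_partialSum_le (1 / 4 : ℂ) (-1 / 4) d
  set A := polyA a m n with hA
  set B := polyB a n with hB
  have hdeg : A.natDegree = B.natDegree + d := by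
    rw [hA, hB, natDegree_polyA, natDegree_polyB, hd]; omega
  have hcA := bTop_pos a
  set K₁ : ℝ := bTop a * (CG * l1norm A * 2 ^ (A.natDegree + 1)) with hK₁
  set K₂ : ℕ → ℝ := fun k => bTop a * (|q4 k| * 2 ^ k *
      (l1norm (A %ₘ (B * polyPi a k)) * 2 ^ (B * polyPi a k).natDegree)) with hK₂
  have hK₁0 : 0 ≤ K₁ := by have := l1norm_nonneg A; positivity
  have hK₂0 : ∀ k, 0 ≤ K₂ k := fun k => by
    have := l1norm_nonneg (A %ₘ (B * polyPi a k)); simp only [hK₂]; positivity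
  refine ⟨2 * R + 2, K₁ + ∑ k ∈ Finset.range (d + 1), K₂ k, by positivity,
    add_nonneg hK₁0 (Finset.sum_nonneg fun k _ => hK₂0 k), ?_⟩
  intro s hs hsR
  have hs1 : 1 ≤ ‖s‖ := le_trans hs.le (Complex.re_le_norm s)
  have hs0 : 0 < ‖s‖ := by linarith
  -- the point `v = (s+a)/2`
  set v : ℂ := (s + a) / 2 with hv
  have hv_re : 0 < v.re := by
    simp only [hv, Complex.div_re, Complex.add_re, Complex.natCast_re]
    norm_num
    have := (a.cast_nonneg : (0:ℝ) ≤ a); nlinarith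
  have hv_norm : ‖s‖ / 2 ≤ ‖v‖ := by
    have h1 : ‖s‖ ≤ ‖s + (a : ℂ)‖ := norm_le_norm_add_nat (v := s) (by linarith) a
    have h2 : ‖v‖ = ‖s + (a : ℂ)‖ / 2 := by
      rw [hv, norm_div]
      norm_num
    rw [h2]; linarith
  have hv0 : 0 < ‖v‖ := by linarith
  have hvR : R ≤ ‖v‖ := by linarith
  have hGv := hG v hv_re hvR
  -- `T_d(v)` in Booker's variables
  have hT : partialSum (1 / 4) (-1 / 4) d v =
      ∑ k ∈ Finset.range (d + 1), (q4 k : ℂ) * (2 ^ k / aeval s (polyPi a k)) := by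
    simp only [partialSum, coeff_quarter, hv, invRising_half]
  -- nonvanishing of the denominators
  have hB0 : aeval s B ≠ 0 := aeval_linProd_ne_zero (polyB_shift_ge a) _ (by linarith)
  have hPi0 : ∀ k, aeval s (polyPi a k) ≠ 0 := fun k =>
    aeval_linProd_ne_zero (polyPi_shift_ge a) _ (by linarith)
  -- Euclidean division, evaluated at `s`
  have hdiv : ∀ k, aeval s A = aeval s (A %ₘ (B * polyPi a k)) +
      aeval s B * aeval s (polyPi a k) * aeval s (A /ₘ (B * polyPi a k)) := by
    intro k
    have h := congrArg (aeval s) (modByMonic_add_div A (B * polyPi a k))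
    simp only [map_add, map_mul] at h
    exact h.symm
  -- the identity for `lemma3E`
  have hk : ∀ k ∈ Finset.range (d + 1),
      (q4 k : ℂ) * (2 ^ k / aeval s (polyPi a k)) * (aeval s A / aeval s B) =
        (q4 k : ℂ) * 2 ^ k * aeval s (A /ₘ (B * polyPi a k)) +
          (q4 k : ℂ) * (2 ^ k * (aeval s (A %ₘ (B * polyPi a k)) /
            (aeval s B * aeval s (polyPi a k)))) := by
    intro k _
    have hP := hPi0 k
    rw [hdiv k]
    field_simp
    ring
  have hsum : (∑ k ∈ Finset.range (d + 1), (q4 k : ℂ) * (2 ^ k / aeval s (polyPi a k))) *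
      (aeval s A / aeval s B) =
      ∑ k ∈ Finset.range (d + 1), (q4 k : ℂ) * 2 ^ k * aeval s (A /ₘ (B * polyPi a k)) +
        ∑ k ∈ Finset.range (d + 1), (q4 k : ℂ) * (2 ^ k * (aeval s (A %ₘ (B * polyPi a k)) /
          (aeval s B * aeval s (polyPi a k)))) := by
    rw [Finset.sum_mul, ← Finset.sum_add_distrib]
    exact Finset.sum_congr rfl hk
  have hE : lemma3E a m n s =
      (bTop a : ℂ) * ((gaussRatio (1 / 4) (-1 / 4) v - partialSum (1 / 4) (-1 / 4) d v) *
        (aeval s A / aeval s B)) +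
      (bTop a : ℂ) * ∑ k ∈ Finset.range (d + 1), (q4 k : ℂ) * (2 ^ k *
        (aeval s (A %ₘ (B * polyPi a k)) / (aeval s B * aeval s (polyPi a k)))) := by
    rw [lemma3E, lemma3F_eq a m n hs.le, aeval_polyP, hT, sub_mul, hsum]
    simp only [← hA, ← hB, ← hd, ← hv]
    ring
  -- bounds: the main term
  have hA_le : ‖aeval s A‖ ≤ l1norm A * ‖s‖ ^ A.natDegree := norm_aeval_le A hs1
  have hB_ge : (‖s‖ / 2) ^ B.natDegree ≤ ‖aeval s B‖ := by
    rw [hB, natDegree_polyB]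
    exact pow_le_norm_aeval_linProd (polyB_shift_ge a) _ hs
  have hGT : ‖gaussRatio (1 / 4) (-1 / 4) v - partialSum (1 / 4) (-1 / 4) d v‖ ≤
      CG / (‖s‖ / 2) ^ (d + 1) := by
    refine hGv.trans ?_
    exact div_le_div_of_nonneg_left hCG (pow_pos (by linarith) _)
      (pow_le_pow_left₀ (by positivity) hv_norm _)
  have hmain : ‖(gaussRatio (1 / 4) (-1 / 4) v - partialSum (1 / 4) (-1 / 4) d v) *
      (aeval s A / aeval s B)‖ ≤ CG * l1norm A * 2 ^ (A.natDegree + 1) / ‖s‖ := by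
    rw [norm_mul, norm_div, ← mul_div_assoc]
    exact main_term_bound hs1 hCG (l1norm_nonneg A) (norm_nonneg _) hGT hA_le hB_ge hdeg
  -- bounds: the remainder terms
  have hrem : ∀ k ∈ Finset.range (d + 1),
      ‖(q4 k : ℂ) * (2 ^ k * (aeval s (A %ₘ (B * polyPi a k)) /
        (aeval s B * aeval s (polyPi a k))))‖ ≤
        |q4 k| * 2 ^ k * (l1norm (A %ₘ (B * polyPi a k)) * 2 ^ (B * polyPi a k).natDegree) / ‖s‖ := by
    intro k _
    set D := B * polyPi a k with hD
    have hDmon : D.Monic := monic_polyD a n k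
    rw [norm_mul, norm_mul, norm_div, norm_pow, Complex.norm_real, Real.norm_eq_abs,
      Complex.norm_two, mul_div_assoc, mul_assoc]
    refine mul_le_mul_of_nonneg_left (mul_le_mul_of_nonneg_left ?_ (by positivity)) (abs_nonneg _)
    rcases Nat.eq_zero_or_pos D.natDegree with hD0 | hDpos
    · -- `D = 1`, remainder `0`
      have hD1 : D = 1 := hDmon.natDegree_eq_zero.mp hD0
      have : A %ₘ D = 0 := by rw [hD1, modByMonic_one]
      rw [this, map_zero, norm_zero, zero_div]
      exact div_nonneg (mul_nonneg (l1norm_nonneg _) (by positivity)) (norm_nonneg _)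
    · have hD1 : D ≠ 1 := by
        intro h; rw [h, natDegree_one] at hDpos; exact lt_irrefl _ hDpos
      have hRdeg : (A %ₘ D).natDegree ≤ D.natDegree - 1 := by
        have := natDegree_modByMonic_lt A hDmon hD1; omega
      have hX : ‖aeval s (A %ₘ D)‖ ≤ l1norm (A %ₘ D) * ‖s‖ ^ (D.natDegree - 1) :=
        (norm_aeval_le _ hs1).trans
          (mul_le_mul_of_nonneg_left (pow_le_pow_right₀ hs1 hRdeg) (l1norm_nonneg _))
      have hND : D.natDegree = B.natDegree + k := by
        rw [hD, hB, natDegree_polyD, natDegree_polyB]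
      have hPi_ge : (‖s‖ / 2) ^ k ≤ ‖aeval s (polyPi a k)‖ :=
        pow_le_norm_aeval_linProd (polyPi_shift_ge a) k hs
      have hY : (‖s‖ / 2) ^ D.natDegree ≤ ‖aeval s B * aeval s (polyPi a k)‖ := by
        rw [hND, norm_mul, pow_add]
        exact mul_le_mul hB_ge hPi_ge (by positivity) (norm_nonneg _)
      exact rem_term_bound hs1 (norm_nonneg _) hX hY hDpos
  -- assemble
  have h1 : ‖(bTop a : ℂ) * ((gaussRatio (1 / 4) (-1 / 4) v - partialSum (1 / 4) (-1 / 4) d v) *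
      (aeval s A / aeval s B))‖ ≤ K₁ / ‖s‖ := by
    rw [norm_mul, Complex.norm_real, Real.norm_eq_abs, abs_of_pos hcA, hK₁, mul_div_assoc]
    exact mul_le_mul_of_nonneg_left hmain hcA.le
  have h2 : ‖(bTop a : ℂ) * ∑ k ∈ Finset.range (d + 1), (q4 k : ℂ) * (2 ^ k *
      (aeval s (A %ₘ (B * polyPi a k)) / (aeval s B * aeval s (polyPi a k))))‖ ≤
      (∑ k ∈ Finset.range (d + 1), K₂ k) / ‖s‖ := by
    rw [norm_mul, Complex.norm_real, Real.norm_eq_abs, abs_of_pos hcA]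
    calc bTop a * ‖∑ k ∈ Finset.range (d + 1), (q4 k : ℂ) * (2 ^ k *
          (aeval s (A %ₘ (B * polyPi a k)) / (aeval s B * aeval s (polyPi a k))))‖
        ≤ bTop a * ∑ k ∈ Finset.range (d + 1), ‖(q4 k : ℂ) * (2 ^ k *
          (aeval s (A %ₘ (B * polyPi a k)) / (aeval s B * aeval s (polyPi a k))))‖ :=
          mul_le_mul_of_nonneg_left (norm_sum_le _ _) hcA.le
      _ ≤ bTop a * ∑ k ∈ Finset.range (d + 1), |q4 k| * 2 ^ k *
          (l1norm (A %ₘ (B * polyPi a k)) * 2 ^ (B * polyPi a k).natDegree) / ‖s‖ :=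
          mul_le_mul_of_nonneg_left (Finset.sum_le_sum hrem) hcA.le
      _ = (∑ k ∈ Finset.range (d + 1), K₂ k) / ‖s‖ := by
          rw [Finset.mul_sum, Finset.sum_div]
          refine Finset.sum_congr rfl fun k _ => ?_
          simp only [hK₂]
          ring
  rw [hE, add_div]
  exact (norm_add_le _ _).trans (add_le_add h1 h2)

/-- **Step A.** `‖E_n(s)‖ ≤ C/‖s‖` on the whole half-plane `Re s > 1` (large `|s|` by
`stepA_large`, bounded `|s|` by continuity on a compact set). [cite: Booker2003, Lemma 3 p. 1094] -/
lemma stepA (a m : ℕ) (ham : a ≤ m) (n : ℤ) (hn : n ≤ m) :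
    ∃ C : ℝ, 0 ≤ C ∧ ∀ s : ℂ, 1 < s.re → ‖lemma3E a m n s‖ ≤ C / ‖s‖ := by
  obtain ⟨R₀, K, hR₀, hK, hlarge⟩ := stepA_large a m ham n hn
  set S : Set ℂ := {s : ℂ | 1 ≤ s.re ∧ ‖s‖ ≤ R₀} with hSdef
  have hS : IsCompact S := by
    refine (isCompact_closedBall (0 : ℂ) R₀).of_isClosed_subset ?_ ?_
    · exact (isClosed_le continuous_const Complex.continuous_re).inter
        (isClosed_le continuous_norm continuous_const)
    · intro s hs
      simpa using hs.2
  have hcont : ContinuousOn (lemma3E a m n) S := fun s hs =>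
    (differentiableAt_lemma3E a m n hs.1).continuousAt.continuousWithinAt
  obtain ⟨M, hM⟩ := hS.exists_bound_of_continuousOn hcont
  refine ⟨max K (max M 0 * R₀), by positivity, fun s hs => ?_⟩
  have hs0 : 0 < ‖s‖ := lt_of_lt_of_le (by linarith) (le_trans hs.le (Complex.re_le_norm s))
  rcases le_or_gt R₀ ‖s‖ with h | h
  · exact (hlarge s hs h).trans (div_le_div_of_nonneg_right (le_max_left _ _) hs0.le)
  · have h1 : ‖lemma3E a m n s‖ ≤ M := hM s ⟨hs.le, h.le⟩
    calc ‖lemma3E a m n s‖ ≤ max M 0 := h1.trans (le_max_left _ _)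
      _ = max M 0 * R₀ / R₀ := by field_simp
      _ ≤ max M 0 * R₀ / ‖s‖ := div_le_div_of_nonneg_left (by positivity) hs0 h.le
      _ ≤ max K (max M 0 * R₀) / ‖s‖ := div_le_div_of_nonneg_right (le_max_right _ _) hs0.le

/-! ### Step B: the polynomial parts are compatible (`b_k` independent of `n`) -/

/-- The top case: `P_m = c_a`. [folklore] -/
lemma polyP_top (a m : ℕ) (ham : a ≤ m) : polyP a m m = C (bTop a) := by
  have hmA : (polyA a m m).Monic := monic_polyA a m m
  have hmB : (polyB a m).Monic := monic_linProd _ _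
  have hnat : (polyA a m m).natDegree = (polyB a m).natDegree := by
    rw [natDegree_polyA, natDegree_polyB]; omega
  have hdeg : (polyA a m m).degree = (polyB a m).degree := by
    rw [degree_eq_natDegree hmA.ne_zero, degree_eq_natDegree hmB.ne_zero, hnat]
  have hlt : (polyA a m m - polyB a m).degree < (polyB a m).degree := by
    rw [← hdeg]
    exact degree_sub_lt hdeg hmA.ne_zero (by rw [hmA.leadingCoeff, hmB.leadingCoeff])
  have hq : polyA a m m /ₘ (polyB a m * polyPi a 0) = 1 := by
    rw [polyPi, linProd_zero, mul_one]
    exact (div_modByMonic_unique 1 (polyA a m m - polyB a m) hmB ⟨by ring, hlt⟩).1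
  rw [polyP, show ((m : ℤ) - (m : ℤ)).toNat = 0 by omega]
  simp [hq, q4]

/-- **Step B.** For `n < m` the polynomial `P_n − (X + n − 1/2) P_{n+1}` is a constant: it equals
`−E_n + (s + n − 1/2) E_{n+1}` on `Re s > 1` (exact recursion `F_n = (s + n − 1/2) F_{n+1}`), which
is bounded as real `s → +∞`, and a bounded real polynomial is constant. [cite: Booker2003, (14) p. 1094] -/
lemma polyP_sub_eq_C (a m : ℕ) (ham : a ≤ m) (n : ℤ) (hn : n < m) :
    ∃ c : ℝ, polyP a m n - (X + C ((n : ℝ) - 1 / 2)) * polyP a m (n + 1) = C c := by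
  set Δ := polyP a m n - (X + C ((n : ℝ) - 1 / 2)) * polyP a m (n + 1) with hΔ
  obtain ⟨C₁, hC₁, h₁⟩ := stepA a m ham n hn.le
  obtain ⟨C₂, hC₂, h₂⟩ := stepA a m ham (n + 1) (by omega)
  set M : ℝ := C₁ + C₂ * (2 + |(n : ℝ)|) with hM
  -- the bound on the real axis
  have hbound : ∀ x : ℝ, 2 ≤ x → |Δ.eval x| ≤ M := by
    intro x hx
    have hxre : 1 < (x : ℂ).re := by simp; linarith
    have hx0 : 0 < x := by linarith
    have hxn : ‖(x : ℂ)‖ = x := by rw [Complex.norm_real, Real.norm_eq_abs, abs_of_pos hx0]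
    have e : ((Δ.eval x : ℝ) : ℂ) = aeval (x : ℂ) Δ := by
      rw [← Complex.coe_algebraMap, aeval_algebraMap_apply_eq_algebraMap_eval]
    have hval : aeval (x : ℂ) Δ = -lemma3E a m n x + ((x : ℂ) + n - 1 / 2) * lemma3E a m (n + 1) x := by
      simp only [hΔ, map_sub, map_mul, map_add, aeval_X, aeval_C, Complex.coe_algebraMap, lemma3E]
      rw [lemma3F_eq_mul_succ a m n (x : ℂ)]
      push_cast
      ring
    have hE1 := h₁ x hxre
    have hE2 := h₂ x hxre
    rw [hxn] at hE1 hE2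
    have hx1 : C₁ / x ≤ C₁ := div_le_self hC₁ (by linarith)
    have hcoef : ‖(x : ℂ) + n - 1 / 2‖ ≤ x + |(n : ℝ)| + 1 / 2 := by
      calc ‖(x : ℂ) + n - 1 / 2‖ ≤ ‖(x : ℂ) + n‖ + ‖(1 / 2 : ℂ)‖ := norm_sub_le _ _
        _ ≤ ‖(x : ℂ)‖ + ‖(n : ℂ)‖ + ‖(1 / 2 : ℂ)‖ := by gcongr; exact norm_add_le _ _
        _ = x + |(n : ℝ)| + 1 / 2 := by
            rw [hxn, Complex.norm_intCast]
            norm_num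
    have hx2 : (x + |(n : ℝ)| + 1 / 2) * (C₂ / x) ≤ C₂ * (2 + |(n : ℝ)|) := by
      rw [← mul_div_assoc, div_le_iff₀ hx0]
      nlinarith [mul_nonneg hC₂ (by linarith : (0:ℝ) ≤ x - 2),
        mul_nonneg (mul_nonneg hC₂ (abs_nonneg (n : ℝ))) (by linarith : (0:ℝ) ≤ x - 1), hC₂,
        abs_nonneg (n : ℝ)]
    calc |Δ.eval x| = ‖((Δ.eval x : ℝ) : ℂ)‖ := by
          rw [Complex.norm_real, Real.norm_eq_abs]
      _ = ‖-lemma3E a m n x + ((x : ℂ) + n - 1 / 2) * lemma3E a m (n + 1) x‖ := by rw [e, hval]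
      _ ≤ ‖lemma3E a m n x‖ + ‖(x : ℂ) + n - 1 / 2‖ * ‖lemma3E a m (n + 1) x‖ := by
          refine (norm_add_le _ _).trans ?_
          rw [norm_neg, norm_mul]
      _ ≤ C₁ / x + (x + |(n : ℝ)| + 1 / 2) * (C₂ / x) := by
          gcongr
      _ ≤ M := by rw [hM]; linarith
  -- a bounded real polynomial is constant
  have hdeg : Δ.degree ≤ 0 := by
    by_contra hlt
    have hlt' : 0 < Δ.degree := lt_of_not_ge hlt
    have ht := Polynomial.abs_tendsto_atTop Δ hlt'
    rw [Filter.tendsto_atTop_atTop] at ht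
    obtain ⟨x₀, hx₀⟩ := ht (M + 1)
    have h1 := hx₀ (max x₀ 2) (le_max_left _ _)
    have h2 := hbound (max x₀ 2) (le_max_right _ _)
    linarith
  exact ⟨Δ.coeff 0, eq_C_of_degree_le_zero hdeg⟩

/-- Booker's numbers `b_k` (`k ≤ m`; extended by `0` above `m`): `b_m = c_a = 2^{−a}√(8π)` and,
for `k < m`, the constant `P_k − (X + k − 1/2) P_{k+1}`. [cite: Booker2003, Lemma 3 p. 1094] -/
def bCoeff (a m : ℕ) (k : ℤ) : ℝ :=
  if k = m then bTop a
  else if k < m then (polyP a m k - (X + C ((k : ℝ) - 1 / 2)) * polyP a m (k + 1)).coeff 0 else 0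

/-- `b_m = c_a`. [folklore] -/
lemma bCoeff_top (a m : ℕ) : bCoeff a m m = bTop a := by simp [bCoeff]

/-- The recursion `P_n = (X + n − 1/2) P_{n+1} + b_n` for `n < m`. [folklore] -/
lemma polyP_eq_succ (a m : ℕ) (ham : a ≤ m) (n : ℤ) (hn : n < m) :
    polyP a m n = (X + C ((n : ℝ) - 1 / 2)) * polyP a m (n + 1) + C (bCoeff a m n) := by
  obtain ⟨c, hc⟩ := polyP_sub_eq_C a m ham n hn
  have hb : bCoeff a m n = c := by
    rw [bCoeff, if_neg hn.ne, if_pos hn, hc, coeff_C_zero]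
  rw [hb, ← hc]
  ring

/-- **Newton form.** For `n ≤ m` (with `m − n = d`):
`P_n = Σ_{j ≤ d} b_{n+j} ∏_{i<j} (X + n + i − 1/2)`. [cite: Booker2003, (12)/(14) p. 1094] -/
lemma polyP_newton (a m : ℕ) (ham : a ≤ m) (d : ℕ) :
    ∀ n : ℤ, (m : ℤ) - n = d →
      polyP a m n = ∑ j ∈ Finset.range (d + 1),
        C (bCoeff a m (n + j)) * linProd (fun i => (n : ℝ) + i - 1 / 2) j := by
  induction d with
  | zero =>
    intro n hn
    obtain rfl : n = m := by omega
    simp [polyP_top a m ham, bCoeff_top]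
  | succ d ih =>
    intro n hn
    rw [polyP_eq_succ a m ham n (by omega), ih (n + 1) (by omega), Finset.sum_range_succ' _ (d + 1)]
    simp only [Nat.cast_zero, add_zero, linProd_zero, mul_one, Finset.mul_sum]
    congr 1
    refine Finset.sum_congr rfl fun j _ => ?_
    rw [linProd_succ']
    have e1 : (n : ℤ) + 1 + (j : ℤ) = n + ((j + 1 : ℕ) : ℤ) := by push_cast; ring
    have e2 : (fun i : ℕ => ((n + 1 : ℤ) : ℝ) + (i : ℝ) - 1 / 2) =
        (fun i : ℕ => (n : ℝ) + ((i + 1 : ℕ) : ℝ) - 1 / 2) := by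
      funext i; push_cast; ring
    rw [e1, e2]
    simp only [Nat.cast_zero, add_zero]
    ring

/-! ### Assembly -/

/-- Reindexing `Σ_{k ∈ [n, m]} f(k) = Σ_{j ≤ m−n} f(n + j)`. [folklore] -/
lemma sum_Icc_eq_sum_range {M : Type*} [AddCommMonoid M] (f : ℤ → M) {n m : ℤ} (h : n ≤ m) :
    ∑ k ∈ Finset.Icc n m, f k = ∑ j ∈ Finset.range ((m - n).toNat + 1), f (n + j) := by
  have hset : Finset.Icc n m =
      (Finset.range ((m - n).toNat + 1)).image (fun j : ℕ => n + (j : ℤ)) := by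
    ext k
    simp only [Finset.mem_Icc, Finset.mem_image, Finset.mem_range]
    constructor
    · intro hk
      exact ⟨(k - n).toNat, by omega, by omega⟩
    · rintro ⟨j, hj, rfl⟩
      omega
  rw [hset, Finset.sum_image]
  intro i _ j _ hij
  simpa using hij

/-- `Γ(z + j) = (∏_{i<j} (z + i)) Γ(z)` when `Γ(z) ≠ 0`. [folklore] -/
lemma Gamma_add_nat_eq (z : ℂ) (hz : Gamma z ≠ 0) (j : ℕ) :
    Gamma (z + j) = (∏ i ∈ Finset.range j, (z + i)) * Gamma z := by
  have h := inv_Gamma_eq_prod_mul z j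
  have hzj : Gamma (z + j) ≠ 0 := by
    intro h0
    rw [h0, inv_zero, mul_zero, inv_eq_zero] at h
    exact hz h
  field_simp at h
  -- h : Gamma (z + j) = Gamma z * ∏ ... (some normal form); conclude
  linear_combination h

/-! ### Booker's (13) and Lemma 3 -/

/-- **Booker 2003, formula (13)** (p. 1094), in the inverse-factorial basis: for every `K` there
are `R, C` such that for `Re s ≥ 1`, `‖s‖ ≥ R`,

  `‖Γ(s/2)²/(2^{−s} Γ(s − 1/2)) − √(8π) Σ_{k ≤ K} q_k/((s/2)(s/2+1)⋯(s/2+k−1))‖ ≤ C/‖s‖^{K+1}`,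

`q_k = (1/4)_k(−1/4)_k/k!` (`q_0 = 1`). Booker states (13) in powers of `1/s`
(`√(8π)(1 + c₁/s + ⋯ + c_n/s^n + O(s^{−n−1}))`, "Stirling's formula gives"); the two forms are
equivalent to every order since `1/((s/2)⋯(s/2+k−1)) = (2/s)^k (1 + O(1/s))`, and this one is what
the proof of Lemma 3 below consumes. Proof: duplication formula + the asymptotic Gauss summation
`Literature.Analysis.SpecialFunctions.GaussRatio.norm_gaussRatio_sub_partialSum_le` (no Stirling series needed).
[cite: Booker2003, (13) p. 1094] -/
theorem gammaFactor_ratio_expansion (K : ℕ) :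
    ∃ R C : ℝ, 0 < R ∧ 0 ≤ C ∧ ∀ s : ℂ, 1 ≤ s.re → R ≤ ‖s‖ →
      ‖Gamma (s / 2) ^ 2 / ((2 : ℂ) ^ (-s) * Gamma (s - 1 / 2)) -
        (Real.sqrt (8 * Real.pi) : ℂ) * partialSum (1 / 4) (-1 / 4) K (s / 2)‖ ≤
        C / ‖s‖ ^ (K + 1) := by
  obtain ⟨R, C, hR, hC, h⟩ := norm_gaussRatio_sub_partialSum_le (1 / 4 : ℂ) (-1 / 4) K
  refine ⟨2 * R, Real.sqrt (8 * Real.pi) * C * 2 ^ (K + 1), by positivity, by positivity, ?_⟩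
  intro s hs hsR
  have hs0 : 0 < ‖s‖ := lt_of_lt_of_le (by linarith) (le_trans hs (Complex.re_le_norm s))
  have h2 : ∀ w : ℂ, (2 : ℂ) ^ w ≠ 0 := fun w => by
    rw [Ne, cpow_eq_zero_iff, not_and_or]; exact Or.inl two_ne_zero
  have hid : Gamma (s / 2) ^ 2 / ((2 : ℂ) ^ (-s) * Gamma (s - 1 / 2)) =
      (Real.sqrt (8 * Real.pi) : ℂ) * gaussRatio (1 / 4) (-1 / 4) (s / 2) := by
    have hd := two_cpow_mul_Gamma_half_sq (z := s) (by linarith)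
    have hΓ : Gamma (s - 1 / 2) ≠ 0 := Gamma_ne_zero_of_re_pos (by simp; linarith)
    rw [div_eq_iff (mul_ne_zero (h2 _) hΓ), cpow_neg]
    have h2s := h2 s
    calc Gamma (s / 2) ^ 2 = ((2 : ℂ) ^ s)⁻¹ * ((2 : ℂ) ^ s * Gamma (s / 2) ^ 2) := by
          rw [← mul_assoc, inv_mul_cancel₀ h2s, one_mul]
      _ = ((2 : ℂ) ^ s)⁻¹ * ((Real.sqrt (8 * Real.pi) : ℂ) * Gamma (s - 1 / 2) *
            gaussRatio (1 / 4) (-1 / 4) (s / 2)) := by rw [hd]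
      _ = (Real.sqrt (8 * Real.pi) : ℂ) * gaussRatio (1 / 4) (-1 / 4) (s / 2) *
            (((2 : ℂ) ^ s)⁻¹ * Gamma (s - 1 / 2)) := by ring
  rw [hid, ← mul_sub, norm_mul, Complex.norm_real, Real.norm_eq_abs,
    abs_of_nonneg (Real.sqrt_nonneg _)]
  have hv_re : 0 < (s / 2).re := by simp; linarith
  have hv_norm : ‖s / 2‖ = ‖s‖ / 2 := by rw [norm_div]; norm_num
  have hvR : R ≤ ‖s / 2‖ := by rw [hv_norm]; linarith
  have hb := h (s / 2) hv_re hvR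
  rw [hv_norm, div_pow] at hb
  calc Real.sqrt (8 * Real.pi) * ‖gaussRatio (1 / 4) (-1 / 4) (s / 2) -
        partialSum (1 / 4) (-1 / 4) K (s / 2)‖
      ≤ Real.sqrt (8 * Real.pi) * (C / (‖s‖ ^ (K + 1) / 2 ^ (K + 1))) :=
        mul_le_mul_of_nonneg_left hb (Real.sqrt_nonneg _)
    _ = Real.sqrt (8 * Real.pi) * C * 2 ^ (K + 1) / ‖s‖ ^ (K + 1) := by
        field_simp

/-- **Booker 2003, Lemma 3** (p. 1094). "Let `m` be given. Then there are numbers `b_k`, with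
`b_m > 0`, such that for any `n`

  `π^{−s} Γ((s+a)/2)² (s − 1/2)^{m−a} = Σ_{k=n}^{m} b_k (2π)^{−s} Γ(s + k − 1/2) + (2π)^{−s} Γ(s + n − 1/2) E_n(s)`,  (12)

where `E_n(s)` is holomorphic and `O(1/s)` in `Re s > 1`." Here `a ∈ {0, 1}` is the parity of the
even Galois representation and `m ≥ a` a positive integer; the statement is proved for every
`a ≤ m` in `ℕ`, every integer `n ≤ m`, with `b_m = 2^{−a}√(8π)` as in (14). (12) is an identity of
meromorphic functions; with Mathlib's convention `1/Γ = 0` at the poles it is asserted at the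
points `s` where `Γ(s + n − 1/2)` is finite, i.e. `Γ(s + n − 1/2) ≠ 0` (automatic for `n ≥ 0`).
Proof as printed ((13)–(14)): the ratio expansion `gammaFactor_ratio_expansion` (through
`GaussRatio.norm_gaussRatio_sub_partialSum_le`), the conversion of `(s−1/2)^m/((s−1/2)⋯(s+m−3/2))
× (1 + c₁/(s+a) + ⋯)` into the basis `1/((s+m−3/2)⋯(s+k−1/2))` by Euclidean division
(`stepA_large`), continuity on compacta (`stepA`), and the independence of the `b_k` from `n`
(`polyP_sub_eq_C`, `polyP_newton`). [cite: Booker2003, Lemma 3 and (12)–(14), p. 1094] -/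
theorem exists_evenGammaFactor_mul_sub_half_pow_eq_sum (a m : ℕ) (ham : a ≤ m) :
    ∃ b : ℤ → ℝ, b m = Real.sqrt (8 * Real.pi) / 2 ^ a ∧ 0 < b m ∧
      ∀ n : ℤ, n ≤ m →
        ∃ E : ℂ → ℂ, DifferentiableOn ℂ E {s : ℂ | 1 < s.re} ∧
          (∃ C : ℝ, ∀ s : ℂ, 1 < s.re → ‖E s‖ ≤ C / ‖s‖) ∧
          ∀ s : ℂ, 1 < s.re → Gamma (s + n - 1 / 2) ≠ 0 →
            (Real.pi : ℂ) ^ (-s) * Gamma ((s + a) / 2) ^ 2 * (s - 1 / 2) ^ (m - a) =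
              ∑ k ∈ Finset.Icc n (m : ℤ),
                  (b k : ℂ) * ((2 * Real.pi : ℂ) ^ (-s) * Gamma (s + k - 1 / 2)) +
                (2 * Real.pi : ℂ) ^ (-s) * Gamma (s + n - 1 / 2) * E s := by
  refine ⟨bCoeff a m, bCoeff_top a m, by rw [bCoeff_top]; exact bTop_pos a, fun n hn => ?_⟩
  refine ⟨lemma3E a m n, fun s hs => (differentiableAt_lemma3E a m n (le_of_lt hs)).differentiableWithinAt,
    ?_, ?_⟩
  · obtain ⟨C, -, hC⟩ := stepA a m ham n hn
    exact ⟨C, hC⟩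
  intro s hs hΓn
  set d := ((m : ℤ) - n).toNat with hd
  -- Newton form, evaluated and multiplied by `Γ(s + n − 1/2)`
  have hP : aeval s (polyP a m n) * Gamma (s + n - 1 / 2) =
      ∑ j ∈ Finset.range (d + 1), (bCoeff a m (n + j) : ℂ) * Gamma (s + (n + j) - 1 / 2) := by
    rw [polyP_newton a m ham d n (by omega), map_sum, Finset.sum_mul]
    refine Finset.sum_congr rfl fun j _ => ?_
    rw [map_mul, aeval_C, Complex.coe_algebraMap, aeval_linProd]
    have hG := Gamma_add_nat_eq (s + n - 1 / 2) hΓn j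
    have e1 : s + ((n : ℂ) + j) - 1 / 2 = s + n - 1 / 2 + j := by ring
    have e2 : ∏ i ∈ Finset.range j, (s + (((n : ℝ) + i - 1 / 2 : ℝ) : ℂ)) =
        ∏ i ∈ Finset.range j, (s + n - 1 / 2 + i) :=
      Finset.prod_congr rfl fun i _ => by push_cast; ring
    rw [e1, hG, e2]
    ring
  have hsum : ∑ k ∈ Finset.Icc n (m : ℤ),
      (bCoeff a m k : ℂ) * ((2 * Real.pi : ℂ) ^ (-s) * Gamma (s + k - 1 / 2)) =
      (2 * Real.pi : ℂ) ^ (-s) * (aeval s (polyP a m n) * Gamma (s + n - 1 / 2)) := by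
    rw [hP, Finset.mul_sum, sum_Icc_eq_sum_range _ hn]
    refine Finset.sum_congr rfl fun j _ => ?_
    push_cast
    ring
  -- the duplication identity and the value of `F_n Γ(s + n − 1/2)`
  have ha0 := (a.cast_nonneg : (0 : ℝ) ≤ a)
  have hdup := two_cpow_mul_Gamma_half_sq (z := s + a) (by simp; linarith)
  have h2 : ∀ w : ℂ, (2 : ℂ) ^ w ≠ 0 := fun w => by
    rw [Ne, cpow_eq_zero_iff, not_and_or]; exact Or.inl two_ne_zero
  have hF : lemma3F a m n s * Gamma (s + n - 1 / 2) = (bTop a : ℂ) * gaussRatio (1 / 4) (-1 / 4)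
      ((s + a) / 2) * (s - 1 / 2) ^ (m - a) * Gamma (s + a - 1 / 2) := by
    have hinv : (Gamma (s + n - 1 / 2))⁻¹ * Gamma (s + n - 1 / 2) = 1 := inv_mul_cancel₀ hΓn
    unfold lemma3F
    linear_combination ((bTop a : ℂ) * gaussRatio (1 / 4) (-1 / 4) ((s + a) / 2) *
      (s - 1 / 2) ^ (m - a) * Gamma (s + a - 1 / 2)) * hinv
  have hE : lemma3E a m n s = lemma3F a m n s - aeval s (polyP a m n) := rfl
  have key : (2 * Real.pi : ℂ) ^ (-s) * Gamma (s + n - 1 / 2) * (lemma3F a m n s - aeval s (polyP a m n)) =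
      (2 * Real.pi : ℂ) ^ (-s) * ((bTop a : ℂ) * gaussRatio (1 / 4) (-1 / 4)
        ((s + a) / 2) * (s - 1 / 2) ^ (m - a) * Gamma (s + a - 1 / 2)) -
      (2 * Real.pi : ℂ) ^ (-s) * (aeval s (polyP a m n) * Gamma (s + n - 1 / 2)) := by
    rw [← hF]
    ring
  rw [hsum, hE, key]
  -- constants: `(2π)^{-s} = 2^{-s} π^{-s}`, `c_a = √(8π)/2^a`, `Γ(v)² = 2^{-s-a} √(8π) Γ(s+a-1/2) G(v)`
  have h2π : (2 * Real.pi : ℂ) ^ (-s) = (2 : ℂ) ^ (-s) * (Real.pi : ℂ) ^ (-s) := by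
    rw [show (2 : ℂ) = ((2 : ℝ) : ℂ) by norm_num]
    exact Complex.mul_cpow_ofReal_nonneg (by norm_num) Real.pi_pos.le (-s)
  have hcA : (bTop a : ℂ) = (Real.sqrt (8 * Real.pi) : ℂ) / 2 ^ a := by
    simp [bTop]
  have hΓv : Gamma ((s + a) / 2) ^ 2 =
      ((2 : ℂ) ^ (s + a))⁻¹ * ((Real.sqrt (8 * Real.pi) : ℂ) * Gamma (s + a - 1 / 2) *
        gaussRatio (1 / 4) (-1 / 4) ((s + a) / 2)) := by
    rw [← hdup, ← mul_assoc, inv_mul_cancel₀ (h2 _), one_mul]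
  have h2sa : ((2 : ℂ) ^ (s + a))⁻¹ = (2 : ℂ) ^ (-s) * ((2 : ℂ) ^ (a : ℕ))⁻¹ := by
    rw [cpow_add _ _ two_ne_zero, cpow_natCast, mul_inv, cpow_neg]
  rw [hΓv, h2sa, h2π, hcA]
  have h2a : (2 : ℂ) ^ (a : ℕ) ≠ 0 := pow_ne_zero _ two_ne_zero
  field_simp
  ring

/-! ### The case `m = 2` used on p. 1097: `b₁/b₂ = −9/8`, and (22) is `−(b₂/2)(2π)^{-s}Γ(s+½)(s−1)²` -/

/-- The quotient of two monic polynomials of the same degree is `1`. [folklore] -/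
lemma divByMonic_eq_one_of_natDegree_eq {f g : ℝ[X]} (hf : f.Monic) (hg : g.Monic)
    (h : f.natDegree = g.natDegree) : f /ₘ g = 1 := by
  have hdeg : f.degree = g.degree := by
    rw [degree_eq_natDegree hf.ne_zero, degree_eq_natDegree hg.ne_zero, h]
  have hlt : (f - g).degree < g.degree := by
    rw [← hdeg]
    exact degree_sub_lt hdeg hf.ne_zero (by rw [hf.leadingCoeff, hg.leadingCoeff])
  exact (div_modByMonic_unique 1 (f - g) hg ⟨by ring, hlt⟩).1

/-- `q4 1 = −1/16`. [folklore] -/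
lemma q4_one : q4 1 = -1 / 16 := by
  rw [show (1 : ℕ) = 0 + 1 from rfl, q4, q4]
  norm_num

/-- For `m = 2` and `a ∈ {0, 1}`: `P_1 = c_a (X − 1/2 − 1/8)` (the terms `k = 0, 1` of (14)).
[cite: Booker2003, (14) p. 1094] -/
lemma polyP_two_one (a : ℕ) (ha : a ≤ 1) :
    polyP a 2 1 = C (bTop a) * (X + C (-1 / 2 : ℝ) + C (-1 / 8 : ℝ)) := by
  -- the two quotients
  have hQ1 : polyA a 2 1 /ₘ (polyB a 1 * polyPi a 1) = 1 := by
    refine divByMonic_eq_one_of_natDegree_eq (monic_polyA a 2 1) (monic_polyD a 1 1) ?_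
    rw [natDegree_polyA, natDegree_polyD]
    omega
  have hQ0 : polyA a 2 1 /ₘ (polyB a 1 * polyPi a 0) = X + C (-1 / 2 : ℝ) := by
    interval_cases a
    · -- `a = 0`: `(X − 1/2)² /ₘ (X − 1/2) = X − 1/2`
      have hA : polyA 0 2 1 = (X + C (-1 / 2 : ℝ)) * (X + C (-1 / 2 : ℝ)) := by
        simp [polyA, linProd, pow_two]
      have hD : polyB 0 1 * polyPi 0 0 = X + C (-1 / 2 : ℝ) := by
        simp [polyB, polyPi, linProd]
        norm_num
      rw [hA, hD, mul_divByMonic_cancel_left _ (monic_X_add_C _)]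
    · -- `a = 1`: `(X − 1/2) /ₘ 1 = X − 1/2`
      have hA : polyA 1 2 1 = X + C (-1 / 2 : ℝ) := by
        simp [polyA, linProd]
      have hD : polyB 1 1 * polyPi 1 0 = 1 := by
        simp [polyB, polyPi, linProd]
      rw [hA, hD, divByMonic_one]
  rw [polyP, show ((2 : ℕ) - (1 : ℤ)).toNat + 1 = 2 by rfl, Finset.sum_range_succ, Finset.sum_range_one,
    hQ0, hQ1, q4_one]
  simp only [q4, pow_zero, mul_one, pow_one]
  have : C ((-1 / 16 : ℝ) * 2) = C (-1 / 8 : ℝ) := by norm_num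
  rw [this]
  simp only [map_one, one_mul]

/-- **Booker 2003, the ratio `b₁/b₂` for `m = 2`.** For `a ∈ {0,1}` the numbers of Lemma 3 with
`m = 2` satisfy `b₁ = −(9/8) b₂` (`b₂ = 2^{−a}√(8π)`). Booker does not compute this ratio ("One can
determine the numbers explicitly, or more simply observe that `L(s, χ)²` …", p. 1097); here it
drops out of (14): `(s−1/2)²/((s−1/2)(s+1/2)) · (1 − 1/(8s) + ⋯) = 1 − (9/8)/(s+1/2) + O(s^{−2})`.
[cite: Booker2003, (22) p. 1097] -/
theorem bCoeff_two_one (a : ℕ) (ha : a ≤ 1) : bCoeff a 2 1 = -(9 / 8) * bTop a := by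
  have h21 : (1 : ℤ) < ((2 : ℕ) : ℤ) := by norm_num
  rw [bCoeff, if_neg (by norm_num), if_pos h21]
  rw [show ((1 : ℤ) + 1) = ((2 : ℕ) : ℤ) by norm_num, polyP_top a 2 (by omega), polyP_two_one a ha]
  simp only [coeff_sub, coeff_add, coeff_X_zero, coeff_C_zero, mul_coeff_zero]
  push_cast
  ring

/-- **Booker 2003, (22) and its conclusion** (p. 1097, `m = 2`, `n = 1`, even case `a ∈ {0,1}`):
with the numbers `b_k` of Lemma 3 for `m = 2`,

  `φ₁(s) = (2π)^{−s} [b₁ Γ(s + 1/2) − (b₂/2) Γ(s + 3/2)(s − 5/2)] = −(b₂/2) (2π)^{−s} Γ(s + 1/2) (s − 1)²`,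

"the above polynomial [`s² − 2s − 5/4 − 2b₁/b₂`] must be `(s − 1)²`. Therefore, `φ₁(s)` has no
zeros strictly inside the critical strip" — here by the explicit value `b₁/b₂ = −9/8`
(`bCoeff_two_one`) instead of the comparison with `L(s, χ)²`. Stated off `s = −1/2` (where
Mathlib's `Γ(0) = 0` breaks `Γ(s + 3/2) = (s + 1/2)Γ(s + 1/2)`). [cite: Booker2003, (22) p. 1097] -/
theorem phi_one_eq (a : ℕ) (ha : a ≤ 1) {s : ℂ} (hs : s + 1 / 2 ≠ 0) :
    (2 * Real.pi : ℂ) ^ (-s) * ((bCoeff a 2 1 : ℂ) * Gamma (s + 1 / 2) -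
      (bCoeff a 2 2 : ℂ) / 2 * Gamma (s + 3 / 2) * (s - 5 / 2)) =
      -((bCoeff a 2 2 : ℂ) / 2) * (2 * Real.pi : ℂ) ^ (-s) * Gamma (s + 1 / 2) * (s - 1) ^ 2 := by
  have hb2 : bCoeff a 2 2 = bTop a := by exact_mod_cast bCoeff_top a 2
  rw [bCoeff_two_one a ha, hb2, show s + 3 / 2 = (s + 1 / 2) + 1 by ring, Gamma_add_one _ hs]
  push_cast
  ring

/-! ### (21)–(22): the `δ`-expansion of Booker's kernel, `φ₀ ≡ 0` and `φ₁` for `m = 2` -/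

/-- The left side of (21): Booker's kernel after Lemmas 2–3,
`K_m(s, δ) = Σ_{k=0}^{m} b_k (2π)^{−s} Γ(s + k − 1/2) (2 sin(δ/2))^{m−k} sin((δ/2)(s − k − 1/2) + πk/2)`,
for an arbitrary coefficient sequence `b`. [cite: Booker2003, (21) p. 1096] -/
def deltaKernel (m : ℕ) (b : ℕ → ℂ) (s δ : ℂ) : ℂ :=
  ∑ k ∈ Finset.range (m + 1), b k * (2 * Real.pi : ℂ) ^ (-s) * Gamma (s + k - 1 / 2) *
    (2 * Complex.sin (δ / 2)) ^ (m - k) * Complex.sin (δ / 2 * (s - k - 1 / 2) + Real.pi * k / 2)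

/-- **`φ₀ ≡ 0` for even `m`** ((21), "By the above, `φ₀(s)` vanishes identically"): at `δ = 0`
every term `k < m` carries a factor `(2 sin 0)^{m−k} = 0` and the term `k = m` the factor
`sin(πm/2) = 0`. [cite: Booker2003, (21) p. 1096] -/
theorem deltaKernel_zero_of_even (m : ℕ) (hm : Even m) (b : ℕ → ℂ) (s : ℂ) :
    deltaKernel m b s 0 = 0 := by
  unfold deltaKernel
  refine Finset.sum_eq_zero fun k hk => ?_
  have hk' : k ≤ m := Nat.lt_succ_iff.mp (Finset.mem_range.mp hk)
  rcases hk'.lt_or_eq with hlt | rfl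
  · have : m - k ≠ 0 := by omega
    simp [zero_pow this]
  · obtain ⟨j, rfl⟩ := hm
    have : Complex.sin ((Real.pi : ℂ) * ((j : ℂ) + j) / 2) = 0 := by
      have h := Complex.sin_int_mul_pi (j : ℤ)
      have e : (Real.pi : ℂ) * ((j : ℂ) + j) / 2 = ((j : ℤ) : ℂ) * Real.pi := by
        push_cast; ring
      rw [e, h]
    simp [this]

/-- **Booker 2003, (22), the derivative.** For `m = 2` and any `b₀, b₁, b₂`: "After
differentiating [the kernel (21)] and setting `δ = 0` we find that this term is
`φ₁(s) = (2π)^{−s} [b₁ Γ(s + 1/2) − (b₂/2) Γ(s + 3/2)(s − 5/2)]`." (The `k = 0` term vanishes to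
third order; `d/dδ (2 sin(δ/2))|₀ = 1`, `sin(π/2) = 1`; `d/dδ sin((δ/2)(s−5/2) + π)|₀ = −(s−5/2)/2`.)
Combined with `phi_one_eq` (`b₁/b₂ = −9/8` for the `b_k` of Lemma 3) this is the polynomial
`(s − 1)²` of p. 1097. [cite: Booker2003, (22) p. 1097] -/
theorem hasDerivAt_deltaKernel_two (b : ℕ → ℂ) (s : ℂ) :
    HasDerivAt (fun δ : ℂ => deltaKernel 2 b s δ)
      ((2 * Real.pi : ℂ) ^ (-s) * (b 1 * Gamma (s + 1 / 2) -
        b 2 / 2 * Gamma (s + 3 / 2) * (s - 5 / 2))) 0 := by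
  -- the building blocks and their derivatives at `0`
  have hu : HasDerivAt (fun δ : ℂ => 2 * Complex.sin (δ / 2)) 1 0 := by
    have h := ((Complex.hasDerivAt_sin ((0 : ℂ) / 2)).comp (0 : ℂ)
      ((hasDerivAt_id' (0 : ℂ)).div_const 2)).const_mul (2 : ℂ)
    refine h.congr_deriv ?_
    norm_num
  have hw : ∀ c θ : ℂ, HasDerivAt (fun δ : ℂ => Complex.sin (δ / 2 * c + θ))
      (Complex.cos θ * (c / 2)) 0 := by
    intro c θ
    have hlin : HasDerivAt (fun δ : ℂ => δ / 2 * c + θ) (c / 2) 0 := by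
      have h := (((hasDerivAt_id' (0 : ℂ)).div_const 2).mul_const c).add_const θ
      exact h.congr_deriv (by ring)
    have h := (Complex.hasDerivAt_sin ((0 : ℂ) / 2 * c + θ)).comp (0 : ℂ) hlin
    exact h.congr_deriv (by simp)
  set c0 : ℂ := (2 * Real.pi : ℂ) ^ (-s) with hc0
  -- term `k = 0`: `u² w`, derivative `0`
  have h0 : HasDerivAt (fun δ : ℂ => b 0 * c0 * Gamma (s - 1 / 2) *
      (2 * Complex.sin (δ / 2)) ^ 2 * Complex.sin (δ / 2 * (s - 1 / 2))) 0 0 := by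
    have hu2 : HasDerivAt (fun δ : ℂ => (2 * Complex.sin (δ / 2)) ^ 2) 0 0 :=
      (hu.pow 2).congr_deriv (by simp)
    have hw0 : HasDerivAt (fun δ : ℂ => Complex.sin (δ / 2 * (s - 1 / 2)))
        (Complex.cos 0 * ((s - 1 / 2) / 2)) 0 := by
      have := hw (s - 1 / 2) 0
      simpa only [add_zero] using this
    have h := (hu2.mul hw0).const_mul (b 0 * c0 * Gamma (s - 1 / 2))
    refine (h.congr_deriv ?_).congr_of_eventuallyEq ?_
    · simp
    · exact Filter.Eventually.of_forall fun δ => by simp only [Pi.mul_apply]; ring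
  -- term `k = 1`: `u w`, derivative `b₁ c Γ(s+1/2)`
  have h1 : HasDerivAt (fun δ : ℂ => b 1 * c0 * Gamma (s + 1 / 2) *
      (2 * Complex.sin (δ / 2)) * Complex.sin (δ / 2 * (s - 3 / 2) + Real.pi / 2))
      (b 1 * c0 * Gamma (s + 1 / 2)) 0 := by
    have hsin : Complex.sin ((Real.pi : ℂ) / 2) = 1 := by exact_mod_cast Real.sin_pi_div_two
    have h := (hu.mul (hw (s - 3 / 2) (Real.pi / 2))).const_mul (b 1 * c0 * Gamma (s + 1 / 2))
    refine (h.congr_deriv ?_).congr_of_eventuallyEq ?_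
    · simp [hsin]
    · exact Filter.Eventually.of_forall fun δ => by simp only [Pi.mul_apply]; ring
  -- term `k = 2`: `w`, derivative `−b₂ c Γ(s+3/2) (s−5/2)/2`
  have h2 : HasDerivAt (fun δ : ℂ => b 2 * c0 * Gamma (s + 3 / 2) *
      Complex.sin (δ / 2 * (s - 5 / 2) + Real.pi))
      (-(b 2 * c0 * Gamma (s + 3 / 2) * ((s - 5 / 2) / 2))) 0 := by
    have h := (hw (s - 5 / 2) Real.pi).const_mul (b 2 * c0 * Gamma (s + 3 / 2))
    rw [Complex.cos_pi] at h
    exact h.congr_deriv (by ring)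
  have hsum := (h0.add h1).add h2
  refine (hsum.congr_deriv ?_).congr_of_eventuallyEq ?_
  · ring
  · refine Filter.Eventually.of_forall fun δ => ?_
    simp only [Pi.add_apply, deltaKernel, Finset.sum_range_succ, Finset.sum_range_zero, zero_add,
      hc0]
    push_cast
    ring_nf

end Booker2003

end Literature.NumberTheory.Automorphic
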